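import Summits.QuantumFields.YangMills.Theorems.BalabanUVNodesN11DiagonalInductionStepCoPH
import Summits.QuantumFields.YangMills.Theorems.BalabanUVNodesN11DiagonalBranchIntegrable
import Summits.QuantumFields.YangMills.Theorems.BalabanUVNodesN11NoExpansionOldBranchIntegrable
import Summits.QuantumFields.YangMills.Theorems.BalabanUVNodesN11DiagonalOldBranchMeasurable
import Literature.MathematicalPhysics.QuantumFieldTheory.Balaban1983to89.Node00.Record13CoreAtTheta13LiveOfRecord

/-!
# DAG node N11 — THEOREM 1 OF [III] ALONG THE WHOLE LARGE-FIELD DIAGONAL AT THE DOOR OF node00-def-K0a's CURED WITNESS FAMILY WITH NO ANALYTIC BINDER: for every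
# `k ≤ K` the post-𝐑 §2 dichotomy of `ρ_k`'s slot at `σ_k` — laws included — from `θ₀.Provisos₁₃Core`, node00-def-T's live-selector clause, `1 ≤ M` (and `0 ≤ g₀, E₀, B₀`
# for the laws) ALONE; at the cured witness of record HYPOTHESIS-FREE (laws: + `0 ≤ g₀`) — dag-n11-d's binder-free diagonal 𝐓-step (`…N11DiagonalBranchIntegrable`,
# integrability by mass preservation; `…N11DiagonalOldBranchMeasurable`, measurability through 11a's operator algebra) in its CLAUSE-keyed form, fed into this seat's
# step-generic diagonal induction `…N11DiagonalInductionStepCoPH`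

Cell `pub-ymgap`, YM-PLAN Track A (HUMAN RULING D-0062), seat `pub-ymgap-dag-n11-e` (g13; R134 fan-out row N11∕s3 «`ThmP245Printed` via `rOperation` from N13's `ROpLeaf`»),
route `BalabanUVNodes` rev 25 (v1.7 `CoPH` key), item K1⁷ `StabilityBAtRecordR13SepCoPH` = stmt-QuantumFields-20542 (helper lane, count-neutral).  [III] = [Balaban1988Convergent],
[IV] = [Balaban1989LargeFieldI].  The last stage of the lineage p536887 (v1.6, `hmB`∕`hCB` displayed) → p543058 ∕ p549594 (v1.7) → `…DiagonalInductionHCBCoPH` (`hCB` only) →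
this file (none), over dag-n11-d's `…N11NoExpansionOldBranchIntegrable` §3 (p547524's old-branch step with the sup bound `hCB` RE-TYPED to integrability `hIB`),
`…N11DiagonalBranchIntegrable` §2 (`integrable_tkBranch_door_of_allLarge`: the old branch along the diagonal at the door IS integrable — mass preservation through `k` full-bond
transports, `|w| ≤ 1`) and `…N11DiagonalOldBranchMeasurable` §4 (`hmB_door_ofCured_of_allLarge`).

WHY THIS FILE.  dag-n11-d's ★★★★ `…DiagonalStepNoBinders.exists_clause_succ_CoPH_door_ofCured_of_allLarge_of_core` is the diagonal 𝐓-step with every binder discharged, keyed on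
`SLaw₁₃CoPH (door) p k` — the §2 form of `ρ_k` at ALL sequences of length `k`.  Along the diagonal the induction only ever owns the CLAUSE at `σ_k` (its output at level `k`),
so the iterable currency is the clause-keyed step; and this seat's step-generic engine (`…DiagonalInductionStepCoPH`) wants it serving EVERY new witness `t′` (to run the zero
witness, whose inductive assumptions (2.27)–(2.31) hold at every index, through the law package).  Both are one remark away from dag-n11-d's files: (i) their clause-keyed
integrable step `clause_succ_CoPH_of_Omega_empty_of_pinChi_of_oldBranch_of_clause_of_integrable` at the door and `σ_{k+1}` has ALL its binders discharged on the diagonal exactly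
as in their ★★★★ proof ((Q)∕(P) `rfl` ∕ `ZrOfRecord₁₃_quad`, (V) `ZrOfRecord₁₃_ζ0_univ_pairCfgAt` + `χ_k(σ_k) ≡ 1`, `hA_of_allLarge`, `hmB_door_ofCured_of_allLarge`,
`integrable_tkBranch_door_of_allLarge`); (ii) along an all-`Ω`-empty sequence the §2 operand is `exp(−g₀⁻²A − E)` for EVERY term-value witness (`sect2Operand_eq_of_forall_Omega_empty`),
so the slot `𝐓_{k+1}(σ_{k+1}) e^{A_{k+1}(σ_{k+1})}` does not read the witness (§0 `sect2Slot_congr_terms_of_forall_Omega_empty`).  HENCE: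
§0 `sect2Operand_congr_terms_of_forall_Omega_empty` ∕ `sect2Slot_congr_terms_of_forall_Omega_empty` (generic: term-freeness of operand and slot along an all-`Ω`-empty sequence).
§1 ★★★★ `clause_succ_forall_terms_doorCured_seqAllLarge_of_clause_of_core` — THE CLAUSE-KEYED DIAGONAL 𝐓-STEP AT THE DOOR WITH NO ANALYTIC BINDER: for `k < K`, from
   `θ₀.Provisos₁₃Core`, `1 ≤ M` and the post-𝐑 clause of `ρ_k` at `σ_k` for `(t₀, E₀)` ALONE, the 𝐓-image clause at `σ_{k+1}` for EVERY `t′` with the same constant — the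
   `hstep` of `…DiagonalInductionStepCoPH`, inhabited.
§2 ★★★★★ `diag_slotClause_all_doorCured_of_provisosCore_of_liveSel_of_core` — THEOREM 1 ALONG THE WHOLE LARGE-FIELD DIAGONAL AT THE DOOR, CLAUSE LEVEL, from `θ₀.Provisos₁₃Core`
   + the selector clause of `θ₀` + `1 ≤ M` ALONE (∀ `k ≤ K`) · `diag_slotClause_succ_forall_terms_doorCured_of_provisosCore_of_liveSel_of_core` (above level 0, every witness) ·
   ★★★★★ `diag_lawsRT_slotClause_all_doorCured_of_provisosCore_of_liveSel_of_core` — WITH ITS LAW PACKAGE (+ `0 ≤ g₀, E₀, B₀`): for every `k ≤ K` BOTH conjuncts of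
   `SLaw₁₃CoPH (door) p k`'s predicate at `σ_k`.
§3 ★★★★★ `diag_slotClause_all_doorCured_theta13LiveOfRecord_of_core` ∕ ★★★★★ `diag_lawsRT_slotClause_all_doorCured_theta13LiveOfRecord_of_core` — AT THE DOOR OF K0a's CURED
   WITNESS OF RECORD `ofHistoryBlind (ofCured (theta13LiveOfRecord F N))` — HYPOTHESIS-FREE (laws: the run's `0 ≤ g₀` only): the K0-class core conjunct at the witness is a
   theorem (`Node00.provisos₁₃Core_theta13LiveOfRecord`, K0a FILE 12a at the member of record), the selector clause K0a's `liveRepin₁₃_liveSel`, `M = 1`, `E₀ = B₀ = 1` by the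
   family's numerals.

HONEST FRAMING.  Count-neutral kernel bookkeeping: ONE history — the all-large-field diagonal `σ_0, σ_1, …, σ_K` (every `Ω_j = Λ_j = ∅`: no small-field region is ever created,
the §2 form there has NO renormalization terms beyond the Wilson action and the run's vacuum constants, and the «inductive assumptions» are those of the ZERO witness) — at ONE
named parameter family (the history-blind door of K0a's cured witnesses).  This is the TERM-FREE corner of Theorem 1: it exercises def-T's ∕ def-R's ∕ K0a's records, 11a's
operator algebra, the fluctuation-integral bookkeeping (3.24)–(3.25) and 𝐑's live-selector bookkeeping end to end with no displayed analytic hypothesis, and NOTHING of [III] §3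
(the bounds (2.27)–(2.31), (2.41)–(2.42) for genuine terms, created at `Ω_{k+1} ≠ ∅`) — the load-bearing content of N11's (S1ᵀ) — is used or asserted.  General histories still
need the A6 inhabitant of (V) off the door (dag-n11-d's `rePinH`, this seat's `…RePinned*` files) AND a measurability law for `Sect2.TermValues` (not in the tree); the dichotomy's
zero branch is not excluded; at a generic `θ₀`, `Provisos₁₃Core` (the K0-class conjunct) remains the honest input — at the witness of record it is a theorem; N11 NOT discharged; K1⁷ NOT closed; counts unmoved (typed 28∕28 · discharged 5∕27).
One finite `𝕋⁴_{L^K}` programme at fixed `ε = L^{−K}`; NOT ℝ⁴, NOT OS, NOT a mass gap, NOT Clay.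
Sources: [III] Thm 1 p.262, §2 p.262, Theorem p.245, (2.17)–(2.18) p.257, (2.20)–(2.25) pp.258–259, (2.27)–(2.31) pp.259–260, (3.1) p.264, (3.16)–(3.22) pp.268–269, (3.24)–(3.25)
p.270, (1.11) p.248; [IV] (0.3)–(0.4) p.176, p.177 (i)–(ii); [Balaban1987RG1] (0.20) p.256; [Balaban1985Averaging] (10) p.19.
-/

noncomputable section

open MeasureTheory
open scoped BigOperators Matrix.Norms.L2Operator

namespace Summit.QuantumFields.YangMills.Theorems.BalabanUVNodesN11DiagonalInductionNoBindersCoPH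

open Literature.MathematicalPhysics.QuantumFieldTheory.Balaban1983to89 T4Continuum Node00 Node00.Tk DagBinding
open B15DeterminingSets
open Literature.MathematicalPhysics.QuantumFieldTheory.Balaban1983to89.B16RLeafRecord13AtLive (liveRepin₁₃_liveSel)
open BalabanUVNodesN11NoExpansionAllLargeCoP (admSOfRecord_init_eq_of_allLarge)
open BalabanUVNodesN11NoExpansionDiagonalCoPH (sect2Operand_eq_of_forall_Omega_empty)
open BalabanUVNodesN11NoExpansionGeneralStepCoPHDoor (chiSeqOfRecord_init_eq_one_of_allLarge hA_of_allLarge)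
open BalabanUVNodesN11DiagonalPinAboveZero (init_seqAllLargeOfRecord)
open BalabanUVNodesN11DiagonalOldBranchMeasurable (hmB_door_ofCured_of_allLarge)
open BalabanUVNodesN11NoExpansionOldBranchIntegrable (clause_succ_CoPH_of_Omega_empty_of_pinChi_of_oldBranch_of_clause_of_integrable)
open BalabanUVNodesN11DiagonalBranchIntegrable (integrable_tkBranch_door_of_allLarge)
open BalabanUVNodesN11DiagonalInductionStepCoPH (diag_slotClause_all_CoPH_of_step_of_liveSel diag_slotClause_succ_forall_terms_CoPH_of_step_of_liveSel
  diag_lawsRT_slotClause_all_doorCured_of_step_of_liveSel diag_lawsRT_slotClause_all_doorCured_theta13LiveOfRecord_of_step)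

variable {F : T4Family} {N : ℕ} [NeZero N]

/-! ## §0. Along an all-`Ω`-empty sequence the §2 operand and slot do not read the term-value witness -/

section TermFree

variable {𝔸 : Type*} [NormedRing 𝔸] [NormedAlgebra ℂ 𝔸] [CompleteSpace 𝔸]
variable {ν : Stage7Numerics} {M : ℕ} {g : ℕ → ℝ} {K n : ℕ}

/-- **THE §2 OPERAND `e^{A_n(s)}` DOES NOT READ THE TERM-VALUE WITNESS ALONG AN ALL-`Ω`-EMPTY SEQUENCE** (it is `exp(−g₀⁻²A(U(W)) − E_n)`: dag-n11-d's
`sect2Operand_eq_of_forall_Omega_empty`; `M ≥ 1`). [cite: Balaban1988Convergent, (2.23)–(2.25) pp.258–259, (2.18) p.257] -/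
theorem sect2Operand_congr_terms_of_forall_Omega_empty (S : Sect2.Setting 𝔸 (SU N)) (Rz : Sect2.Residual (F.P K) 𝔸) (hM : 1 ≤ M)
    (s : SeqOfRecord F ν M g K n) (hΩ : ∀ j, 1 ≤ j → j ≤ n → s.Ω j = ∅) (t t' : Sect2.TermValues (F.P K) 𝔸 (FluctV N) M) (Ek : ℝ) (U : BgMap F N K) :
    sect2Operand F N (FluctV N) K S Rz s t Ek U = sect2Operand F N (FluctV N) K S Rz s t' Ek U := by
  funext a W
  rw [sect2Operand_eq_of_forall_Omega_empty S Rz hM s hΩ t Ek U a W, sect2Operand_eq_of_forall_Omega_empty S Rz hM s hΩ t' Ek U a W]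

/-- **… NOR DOES THE §2-FORM SLOT `𝐓_n(s)[W] e^{A_n(s)}`** (every weight datum, residual, background map). [cite: Balaban1988Convergent, (2.18) p.257, (2.23)–(2.25) pp.258–259] -/
theorem sect2Slot_congr_terms_of_forall_Omega_empty (S : Sect2.Setting 𝔸 (SU N)) (Rz : Sect2.Residual (F.P K) 𝔸) (W : TkWeights F N (FluctV N) K) (hM : 1 ≤ M)
    (s : SeqOfRecord F ν M g K n) (hΩ : ∀ j, 1 ≤ j → j ≤ n → s.Ω j = ∅) (t t' : Sect2.TermValues (F.P K) 𝔸 (FluctV N) M) (Ek : ℝ) (U : BgMap F N K) :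
    sect2Slot F N (FluctV N) K S Rz W s t Ek U = sect2Slot F N (FluctV N) K S Rz W s t' Ek U := by
  unfold sect2Slot
  rw [sect2Operand_congr_terms_of_forall_Omega_empty S Rz hM s hΩ t t' Ek U]

end TermFree

/-! ## §1. ★★★★ The clause-keyed diagonal 𝐓-step at the door of K0a's cured family with NO analytic binder, serving every new witness -/

section DoorCured

variable (θ₀ : Stage13Params F N) (p : B12.RunParams)

/-- **★★★★ THEOREM 1's INDUCTIVE 𝐓-STEP ALONG THE ALL-LARGE-FIELD DIAGONAL AT THE DOOR `ofHistoryBlind (ofCured θ₀)`, CLAUSE-KEYED, NO ANALYTIC BINDER, EVERY NEW WITNESS.**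
For `k < K`, from `θ₀.Provisos₁₃Core`, `1 ≤ M`, and the post-𝐑 §2 clause of `ρ_k` at `σ_k` for ONE witness `(t₀, E₀)` (door residual and weights): the 𝐓-image clause of
`slotT_{k+1}(σ_{k+1})` holds for EVERY `t′` with the same constant `E₀`.  dag-n11-d's clause-keyed integrable old-branch step at the door and `σ_{k+1}` (its `init` is `σ_k`),
with (Q)∕(P)∕`hA`∕(V)∕`hq` discharged as in `…GeneralStepCoPHDoor` ∕ `…DiagonalStepNoBinders`, `hmB` by `hmB_door_ofCured_of_allLarge`, `hIB` by
`…DiagonalBranchIntegrable.integrable_tkBranch_door_of_allLarge`; then §0 moves the witness `t₀ ↦ t′` in the slot at `σ_{k+1}`. [cite: Balaban1988Convergent, Thm 1 p.262, Theorem p.245, (3.24)–(3.25) p.270, (2.18) p.257, (2.20)–(2.25) pp.258–259, (3.1) p.264, (3.16) p.268, (1.11) p.248; Balaban1985Averaging, (10) p.19] -/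
theorem clause_succ_forall_terms_doorCured_seqAllLarge_of_clause_of_core (h : θ₀.Provisos₁₃Core F N) {k : ℕ} (hk : k < p.K) (hM : 1 ≤ θ₀.τ9.M)
    (t₀ : Sect2.TermValues (F.P p.K) (MatA N) (FluctV N) θ₀.τ9.M) (E₀ : ℝ)
    (hid : slotsOfRecord F N θ₀.ν θ₀.τ9 (EOfRecord₁₃ F N θ₀) (wOfRecord₉ F N θ₀.toStage9Params) θ₀.ppSel p (gOfRecord₁₃ F N θ₀ p) k
          (seqAllLargeOfRecord F θ₀.ν θ₀.τ9.M (gOfRecord₁₃ F N θ₀ p) p.K k) = 0 ∨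
        ∀ᵐ U ∂fieldMeasure (F.P p.K) k (SU N),
          chiSeqOfRecord F N θ₀.ν θ₀.τ9.M (gOfRecord₁₃ F N θ₀ p) p.K k (seqAllLargeOfRecord F θ₀.ν θ₀.τ9.M (gOfRecord₁₃ F N θ₀ p) p.K k) U ≠ 0 →
            slotsOfRecord F N θ₀.ν θ₀.τ9 (EOfRecord₁₃ F N θ₀) (wOfRecord₉ F N θ₀.toStage9Params) θ₀.ppSel p (gOfRecord₁₃ F N θ₀ p) k
                (seqAllLargeOfRecord F θ₀.ν θ₀.τ9.M (gOfRecord₁₃ F N θ₀ p) p.K k) U =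
              sect2Slot F N (FluctV N) p.K (settingOfRecord₁₃ F N θ₀ p)
                ((Stage13HParams.ofHistoryBlind F N (Stage13RParams.ofCured F N θ₀)).rzAt p (seqAllLargeOfRecord F θ₀.ν θ₀.τ9.M (gOfRecord₁₃ F N θ₀ p) p.K k))
                (WtOfRecord₁₃H F N (Stage13HParams.ofHistoryBlind F N (Stage13RParams.ofCured F N θ₀)) p
                  (seqAllLargeOfRecord F θ₀.ν θ₀.τ9.M (gOfRecord₁₃ F N θ₀ p) p.K k))
                (seqAllLargeOfRecord F θ₀.ν θ₀.τ9.M (gOfRecord₁₃ F N θ₀ p) p.K k) t₀ E₀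
                (UbgOfRecord₁₃CoP F N θ₀ p k (seqAllLargeOfRecord F θ₀.ν θ₀.τ9.M (gOfRecord₁₃ F N θ₀ p) p.K k)) U)
    (t' : Sect2.TermValues (F.P p.K) (MatA N) (FluctV N) θ₀.τ9.M) :
    slotsTOfRecord F N θ₀.ν θ₀.τ9 (EOfRecord₁₃ F N θ₀) (wOfRecord₉ F N θ₀.toStage9Params) θ₀.ppSel p (gOfRecord₁₃ F N θ₀ p) (k + 1)
        (seqAllLargeOfRecord F θ₀.ν θ₀.τ9.M (gOfRecord₁₃ F N θ₀ p) p.K (k + 1)) = 0 ∨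
      ∀ᵐ V ∂fieldMeasure (F.P p.K) (k + 1) (SU N),
        chiSeqOfRecord F N θ₀.ν θ₀.τ9.M (gOfRecord₁₃ F N θ₀ p) p.K (k + 1)
            (seqAllLargeOfRecord F θ₀.ν θ₀.τ9.M (gOfRecord₁₃ F N θ₀ p) p.K (k + 1)) V ≠ 0 →
          slotsTOfRecord F N θ₀.ν θ₀.τ9 (EOfRecord₁₃ F N θ₀) (wOfRecord₉ F N θ₀.toStage9Params) θ₀.ppSel p (gOfRecord₁₃ F N θ₀ p) (k + 1)
              (seqAllLargeOfRecord F θ₀.ν θ₀.τ9.M (gOfRecord₁₃ F N θ₀ p) p.K (k + 1)) V =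
            sect2Slot F N (FluctV N) p.K (settingOfRecord₁₃ F N θ₀ p)
              ((Stage13HParams.ofHistoryBlind F N (Stage13RParams.ofCured F N θ₀)).rzAt p (seqAllLargeOfRecord F θ₀.ν θ₀.τ9.M (gOfRecord₁₃ F N θ₀ p) p.K (k + 1)))
              (WtOfRecord₁₃H F N (Stage13HParams.ofHistoryBlind F N (Stage13RParams.ofCured F N θ₀)) p
                (seqAllLargeOfRecord F θ₀.ν θ₀.τ9.M (gOfRecord₁₃ F N θ₀ p) p.K (k + 1)))
              (seqAllLargeOfRecord F θ₀.ν θ₀.τ9.M (gOfRecord₁₃ F N θ₀ p) p.K (k + 1)) t' E₀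
              (UbgOfRecord₁₃CoP F N θ₀ p (k + 1) (seqAllLargeOfRecord F θ₀.ν θ₀.τ9.M (gOfRecord₁₃ F N θ₀ p) p.K (k + 1))) V := by
  have hall : ∀ j, 1 ≤ j → j ≤ k + 1 → (seqAllLargeOfRecord F θ₀.ν θ₀.τ9.M (gOfRecord₁₃ F N θ₀ p) p.K (k + 1)).Ω j = ∅ := fun _ _ _ => rfl
  have hinit : (seqAllLargeOfRecord F θ₀.ν θ₀.τ9.M (gOfRecord₁₃ F N θ₀ p) p.K (k + 1)).init = seqAllLargeOfRecord F θ₀.ν θ₀.τ9.M (gOfRecord₁₃ F N θ₀ p) p.K k :=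
    init_seqAllLargeOfRecord (F := F) θ₀.ν θ₀.τ9.M p (gOfRecord₁₃ F N θ₀ p) k
  -- the level-`k` clause, read at `(σ_{k+1}).init`
  have hid' : slotsOfRecord F N θ₀.ν θ₀.τ9 (EOfRecord₁₃ F N θ₀) (wOfRecord₉ F N θ₀.toStage9Params) θ₀.ppSel p (gOfRecord₁₃ F N θ₀ p) k
          (seqAllLargeOfRecord F θ₀.ν θ₀.τ9.M (gOfRecord₁₃ F N θ₀ p) p.K (k + 1)).init = 0 ∨
        ∀ᵐ U ∂fieldMeasure (F.P p.K) k (SU N),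
          chiSeqOfRecord F N θ₀.ν θ₀.τ9.M (gOfRecord₁₃ F N θ₀ p) p.K k (seqAllLargeOfRecord F θ₀.ν θ₀.τ9.M (gOfRecord₁₃ F N θ₀ p) p.K (k + 1)).init U ≠ 0 →
            slotsOfRecord F N θ₀.ν θ₀.τ9 (EOfRecord₁₃ F N θ₀) (wOfRecord₉ F N θ₀.toStage9Params) θ₀.ppSel p (gOfRecord₁₃ F N θ₀ p) k
                (seqAllLargeOfRecord F θ₀.ν θ₀.τ9.M (gOfRecord₁₃ F N θ₀ p) p.K (k + 1)).init U =
              sect2Slot F N (FluctV N) p.K (settingOfRecord₁₃ F N θ₀ p)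
                ((Stage13HParams.ofHistoryBlind F N (Stage13RParams.ofCured F N θ₀)).rzAt p (seqAllLargeOfRecord F θ₀.ν θ₀.τ9.M (gOfRecord₁₃ F N θ₀ p) p.K (k + 1)).init)
                (WtOfRecord₁₃H F N (Stage13HParams.ofHistoryBlind F N (Stage13RParams.ofCured F N θ₀)) p
                  (seqAllLargeOfRecord F θ₀.ν θ₀.τ9.M (gOfRecord₁₃ F N θ₀ p) p.K (k + 1)).init)
                (seqAllLargeOfRecord F θ₀.ν θ₀.τ9.M (gOfRecord₁₃ F N θ₀ p) p.K (k + 1)).init t₀ E₀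
                (UbgOfRecord₁₃CoP F N θ₀ p k (seqAllLargeOfRecord F θ₀.ν θ₀.τ9.M (gOfRecord₁₃ F N θ₀ p) p.K (k + 1)).init) U := by
    rw [hinit]; exact hid
  -- dag-n11-d's clause-keyed old-branch step in integrable form at the door and `σ_{k+1}`, every binder discharged on the diagonal (as in `…DiagonalStepNoBinders` §3)
  have hT := clause_succ_CoPH_of_Omega_empty_of_pinChi_of_oldBranch_of_clause_of_integrable
    (Stage13HParams.ofHistoryBlind F N (Stage13RParams.ofCured F N θ₀)) p h.ofCured.ofHistoryBlind hk hM
    (seqAllLargeOfRecord F θ₀.ν θ₀.τ9.M (gOfRecord₁₃ F N θ₀ p) p.K (k + 1)) rfl (fun j _ ω ω' _ => by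
      show (ZrOfRecord₁₃ F N θ₀ p).quad j _ ω = (ZrOfRecord₁₃ F N θ₀ p).quad j _ ω'
      rw [ZrOfRecord₁₃_quad, ZrOfRecord₁₃_quad])
    (fun _ _ => ⟨rfl, rfl⟩) t₀ E₀ (hA_of_allLarge θ₀ p hM _ hall _ _ t₀ E₀) hid'
    (fun V' U₀ => by
      show (ZrOfRecord₁₃ F N θ₀ p).ζ0 k Set.univ (pairCfgAt (V := FluctV N) k V' U₀) =
        chiSeqOfRecord F N θ₀.ν θ₀.τ9.M (gOfRecord₁₃ F N θ₀ p) p.K k (seqAllLargeOfRecord F θ₀.ν θ₀.τ9.M (gOfRecord₁₃ F N θ₀ p) p.K (k + 1)).init U₀ *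
          wOfRecord₉ F N θ₀.toStage9Params p (gOfRecord₁₃ F N θ₀ p) k (seqAllLargeOfRecord F θ₀.ν θ₀.τ9.M (gOfRecord₁₃ F N θ₀ p) p.K (k + 1)) U₀
            ((avOfRecord F N p.K k).avg U₀)
      rw [chiSeqOfRecord_init_eq_one_of_allLarge θ₀ p _ hall U₀, one_mul]
      exact ZrOfRecord₁₃_ζ0_univ_pairCfgAt hk V' U₀)
    (fun V' U₀ => by
      show (ZrOfRecord₁₃ F N θ₀ p).quad k ∅ (pairCfgAt (V := FluctV N) k V' U₀) = 0
      rw [ZrOfRecord₁₃_quad])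
    (hmB_door_ofCured_of_allLarge p θ₀ h hM _ hall t₀ E₀)
    (fun S hSm => by
      -- the old branch is integrable on the diagonal (dag-n11-d `…DiagonalBranchIntegrable` §2): the old index is the all-empty branch
      have hS0 : S = fun _ => ∅ := by
        have hS1 : S ∈ admSOfRecord F θ₀.ν θ₀.τ9.M (gOfRecord₁₃ F N θ₀ p) p.K k
            (seqAllLargeOfRecord F θ₀.ν θ₀.τ9.M (gOfRecord₁₃ F N θ₀ p) p.K (k + 1)).init := hSm
        rw [admSOfRecord_init_eq_of_allLarge θ₀ p _ hall, Finset.mem_singleton] at hS1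
        exact hS1
      subst hS0
      have hI := integrable_tkBranch_door_of_allLarge θ₀ p h hM (le_of_lt hk)
        ((Stage13HParams.ofHistoryBlind F N (Stage13RParams.ofCured F N θ₀)).rzAt p
          (seqAllLargeOfRecord F θ₀.ν θ₀.τ9.M (gOfRecord₁₃ F N θ₀ p) p.K (k + 1)).init) t₀ E₀ k le_rfl
      rw [← hinit] at hI
      exact hI)
  -- the slot at `σ_{k+1}` does not read the witness: move `t′ ↦ t₀`
  rw [sect2Slot_congr_terms_of_forall_Omega_empty (settingOfRecord₁₃ F N θ₀ p)
    ((Stage13HParams.ofHistoryBlind F N (Stage13RParams.ofCured F N θ₀)).rzAt p (seqAllLargeOfRecord F θ₀.ν θ₀.τ9.M (gOfRecord₁₃ F N θ₀ p) p.K (k + 1)))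
    (WtOfRecord₁₃H F N (Stage13HParams.ofHistoryBlind F N (Stage13RParams.ofCured F N θ₀)) p (seqAllLargeOfRecord F θ₀.ν θ₀.τ9.M (gOfRecord₁₃ F N θ₀ p) p.K (k + 1)))
    hM _ hall t' t₀ E₀ (UbgOfRecord₁₃CoP F N θ₀ p (k + 1) (seqAllLargeOfRecord F θ₀.ν θ₀.τ9.M (gOfRecord₁₃ F N θ₀ p) p.K (k + 1)))]
  exact hT

/-! ## §2. ★★★★★ Theorem 1 along the whole diagonal at the door of K0a's cured family — `Provisos₁₃Core` + selector clause + `1 ≤ M` alone -/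

/-- **★★★★★ THEOREM 1 ALONG THE WHOLE LARGE-FIELD DIAGONAL AT THE DOOR OF K0a's CURED FAMILY — NO ANALYTIC BINDER.**  From `θ₀.Provisos₁₃Core`, node00-def-T's live-selector
clause of `θ₀` and `1 ≤ M` ALONE: for every `k ≤ K` there are term values and a constant with the post-𝐑 §2 dichotomy of `ρ_k`'s slot at `σ_k` at the door's residual and
weights (this seat's step-generic induction `diag_slotClause_all_CoPH_of_step_of_liveSel` over §1). [cite: Balaban1988Convergent, Thm 1 p.262, Theorem p.245, (3.24)–(3.25) p.270, (2.17)–(2.18) p.257, (1.11) p.248, (3.16)–(3.20) pp.268–269; Balaban1989LargeFieldI, (0.3)–(0.4) p.176, p.177 (i)–(ii)] -/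
theorem diag_slotClause_all_doorCured_of_provisosCore_of_liveSel_of_core (h : θ₀.Provisos₁₃Core F N)
    (hsel : θ₀.ppSel = ppSelLiveOfRecord F N θ₀.ν θ₀.τ9 (EOfRecord₁₃ F N θ₀) (wOfRecord₉ F N θ₀.toStage9Params)) (hM : 1 ≤ θ₀.τ9.M) :
    ∀ k, k ≤ p.K → ∃ (t : Sect2.TermValues (F.P p.K) (MatA N) (FluctV N) θ₀.τ9.M) (E : ℝ),
      slotsOfRecord F N θ₀.ν θ₀.τ9 (EOfRecord₁₃ F N θ₀) (wOfRecord₉ F N θ₀.toStage9Params) θ₀.ppSel p (gOfRecord₁₃ F N θ₀ p) k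
          (seqAllLargeOfRecord F θ₀.ν θ₀.τ9.M (gOfRecord₁₃ F N θ₀ p) p.K k) = 0 ∨
        ∀ᵐ U ∂fieldMeasure (F.P p.K) k (SU N),
          chiSeqOfRecord F N θ₀.ν θ₀.τ9.M (gOfRecord₁₃ F N θ₀ p) p.K k (seqAllLargeOfRecord F θ₀.ν θ₀.τ9.M (gOfRecord₁₃ F N θ₀ p) p.K k) U ≠ 0 →
            slotsOfRecord F N θ₀.ν θ₀.τ9 (EOfRecord₁₃ F N θ₀) (wOfRecord₉ F N θ₀.toStage9Params) θ₀.ppSel p (gOfRecord₁₃ F N θ₀ p) k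
                (seqAllLargeOfRecord F θ₀.ν θ₀.τ9.M (gOfRecord₁₃ F N θ₀ p) p.K k) U =
              sect2Slot F N (FluctV N) p.K (settingOfRecord₁₃ F N θ₀ p)
                ((Stage13HParams.ofHistoryBlind F N (Stage13RParams.ofCured F N θ₀)).rzAt p (seqAllLargeOfRecord F θ₀.ν θ₀.τ9.M (gOfRecord₁₃ F N θ₀ p) p.K k))
                (WtOfRecord₁₃H F N (Stage13HParams.ofHistoryBlind F N (Stage13RParams.ofCured F N θ₀)) p
                  (seqAllLargeOfRecord F θ₀.ν θ₀.τ9.M (gOfRecord₁₃ F N θ₀ p) p.K k))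
                (seqAllLargeOfRecord F θ₀.ν θ₀.τ9.M (gOfRecord₁₃ F N θ₀ p) p.K k) t E
                (UbgOfRecord₁₃CoP F N θ₀ p k (seqAllLargeOfRecord F θ₀.ν θ₀.τ9.M (gOfRecord₁₃ F N θ₀ p) p.K k)) U :=
  diag_slotClause_all_CoPH_of_step_of_liveSel (Stage13HParams.ofHistoryBlind F N (Stage13RParams.ofCured F N θ₀)) p h.ofCured.ofHistoryBlind hsel
    fun _ hk t₀ E₀ hid t' => clause_succ_forall_terms_doorCured_seqAllLarge_of_clause_of_core θ₀ p h hk hM t₀ E₀ hid t'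

/-- **… AND ABOVE LEVEL 0 FOR EVERY TERM-VALUE WITNESS, NO ANALYTIC BINDER** (the diagonal is term-free). [cite: Balaban1988Convergent, Thm 1 p.262, (2.20)–(2.23) p.258, (3.24)–(3.25) p.270; Balaban1989LargeFieldI, (0.3) p.176, p.177 (i)–(ii)] -/
theorem diag_slotClause_succ_forall_terms_doorCured_of_provisosCore_of_liveSel_of_core (h : θ₀.Provisos₁₃Core F N)
    (hsel : θ₀.ppSel = ppSelLiveOfRecord F N θ₀.ν θ₀.τ9 (EOfRecord₁₃ F N θ₀) (wOfRecord₉ F N θ₀.toStage9Params)) (hM : 1 ≤ θ₀.τ9.M)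
    (k : ℕ) (hk : k < p.K) (t' : Sect2.TermValues (F.P p.K) (MatA N) (FluctV N) θ₀.τ9.M) :
    ∃ E : ℝ,
      slotsOfRecord F N θ₀.ν θ₀.τ9 (EOfRecord₁₃ F N θ₀) (wOfRecord₉ F N θ₀.toStage9Params) θ₀.ppSel p (gOfRecord₁₃ F N θ₀ p) (k + 1)
          (seqAllLargeOfRecord F θ₀.ν θ₀.τ9.M (gOfRecord₁₃ F N θ₀ p) p.K (k + 1)) = 0 ∨
        ∀ᵐ U ∂fieldMeasure (F.P p.K) (k + 1) (SU N),
          chiSeqOfRecord F N θ₀.ν θ₀.τ9.M (gOfRecord₁₃ F N θ₀ p) p.K (k + 1) (seqAllLargeOfRecord F θ₀.ν θ₀.τ9.M (gOfRecord₁₃ F N θ₀ p) p.K (k + 1)) U ≠ 0 →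
            slotsOfRecord F N θ₀.ν θ₀.τ9 (EOfRecord₁₃ F N θ₀) (wOfRecord₉ F N θ₀.toStage9Params) θ₀.ppSel p (gOfRecord₁₃ F N θ₀ p) (k + 1)
                (seqAllLargeOfRecord F θ₀.ν θ₀.τ9.M (gOfRecord₁₃ F N θ₀ p) p.K (k + 1)) U =
              sect2Slot F N (FluctV N) p.K (settingOfRecord₁₃ F N θ₀ p)
                ((Stage13HParams.ofHistoryBlind F N (Stage13RParams.ofCured F N θ₀)).rzAt p
                  (seqAllLargeOfRecord F θ₀.ν θ₀.τ9.M (gOfRecord₁₃ F N θ₀ p) p.K (k + 1)))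
                (WtOfRecord₁₃H F N (Stage13HParams.ofHistoryBlind F N (Stage13RParams.ofCured F N θ₀)) p
                  (seqAllLargeOfRecord F θ₀.ν θ₀.τ9.M (gOfRecord₁₃ F N θ₀ p) p.K (k + 1)))
                (seqAllLargeOfRecord F θ₀.ν θ₀.τ9.M (gOfRecord₁₃ F N θ₀ p) p.K (k + 1)) t' E
                (UbgOfRecord₁₃CoP F N θ₀ p (k + 1) (seqAllLargeOfRecord F θ₀.ν θ₀.τ9.M (gOfRecord₁₃ F N θ₀ p) p.K (k + 1))) U :=
  diag_slotClause_succ_forall_terms_CoPH_of_step_of_liveSel (Stage13HParams.ofHistoryBlind F N (Stage13RParams.ofCured F N θ₀)) p h.ofCured.ofHistoryBlind hsel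
    (fun _ hk t₀ E₀ hid t' => clause_succ_forall_terms_doorCured_seqAllLarge_of_clause_of_core θ₀ p h hk hM t₀ E₀ hid t') k hk t'

/-- **★★★★★ THEOREM 1 ALONG THE WHOLE LARGE-FIELD DIAGONAL AT THE DOOR OF K0a's CURED FAMILY WITH ITS LAW PACKAGE — NO ANALYTIC BINDER.**  From `θ₀.Provisos₁₃Core`, the
selector clause of `θ₀`, `1 ≤ M`, `0 ≤ g₀` and the signs `0 ≤ E₀, B₀` ALONE: for every `k ≤ K` there are term values and a constant carrying BOTH conjuncts of
`SLaw₁₃CoPH (ofHistoryBlind (ofCured θ₀)) p k`'s predicate at `σ_k` — the inductive assumptions `Sect2.LawsRT (sect2TowerOfRecord … σ_k t) lf k` AND the post-𝐑 §2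
dichotomy of `ρ_k`'s slot (this seat's `diag_lawsRT_slotClause_all_doorCured_of_step_of_liveSel` over §1; zero witness above level 0).
[cite: Balaban1988Convergent, Thm 1 p.262, §2 p.262, Theorem p.245, (3.24)–(3.25) p.270, (2.27)–(2.31) pp.259–260, (1.11) p.248, (3.16)–(3.20) pp.268–269; Balaban1989LargeFieldI, (0.3)–(0.4) p.176, p.177 (i)–(ii); Balaban1987RG1, (0.20) p.256] -/
theorem diag_lawsRT_slotClause_all_doorCured_of_provisosCore_of_liveSel_of_core (h : θ₀.Provisos₁₃Core F N)
    (hg0 : 0 ≤ p.g0) (hE₀ : 0 ≤ θ₀.s2.lf.E₀) (hB₀ : 0 ≤ θ₀.s2.lf.B₀)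
    (hsel : θ₀.ppSel = ppSelLiveOfRecord F N θ₀.ν θ₀.τ9 (EOfRecord₁₃ F N θ₀) (wOfRecord₉ F N θ₀.toStage9Params)) (hM : 1 ≤ θ₀.τ9.M) :
    ∀ k, k ≤ p.K → ∃ (t : Sect2.TermValues (F.P p.K) (MatA N) (FluctV N) θ₀.τ9.M) (E : ℝ),
      Sect2.LawsRT (sect2TowerOfRecord F N (FluctV N) p.K (settingOfRecord₁₃ F N θ₀ p)
        ((Stage13HParams.ofHistoryBlind F N (Stage13RParams.ofCured F N θ₀)).rzAt p (seqAllLargeOfRecord F θ₀.ν θ₀.τ9.M (gOfRecord₁₃ F N θ₀ p) p.K k))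
        (seqAllLargeOfRecord F θ₀.ν θ₀.τ9.M (gOfRecord₁₃ F N θ₀ p) p.K k) t) (settingOfRecord₁₃ F N θ₀ p).lf k ∧
     (slotsOfRecord F N θ₀.ν θ₀.τ9 (EOfRecord₁₃ F N θ₀) (wOfRecord₉ F N θ₀.toStage9Params) θ₀.ppSel p (gOfRecord₁₃ F N θ₀ p) k
          (seqAllLargeOfRecord F θ₀.ν θ₀.τ9.M (gOfRecord₁₃ F N θ₀ p) p.K k) = 0 ∨
        ∀ᵐ U ∂fieldMeasure (F.P p.K) k (SU N),
          chiSeqOfRecord F N θ₀.ν θ₀.τ9.M (gOfRecord₁₃ F N θ₀ p) p.K k (seqAllLargeOfRecord F θ₀.ν θ₀.τ9.M (gOfRecord₁₃ F N θ₀ p) p.K k) U ≠ 0 →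
            slotsOfRecord F N θ₀.ν θ₀.τ9 (EOfRecord₁₃ F N θ₀) (wOfRecord₉ F N θ₀.toStage9Params) θ₀.ppSel p (gOfRecord₁₃ F N θ₀ p) k
                (seqAllLargeOfRecord F θ₀.ν θ₀.τ9.M (gOfRecord₁₃ F N θ₀ p) p.K k) U =
              sect2Slot F N (FluctV N) p.K (settingOfRecord₁₃ F N θ₀ p)
                ((Stage13HParams.ofHistoryBlind F N (Stage13RParams.ofCured F N θ₀)).rzAt p (seqAllLargeOfRecord F θ₀.ν θ₀.τ9.M (gOfRecord₁₃ F N θ₀ p) p.K k))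
                (WtOfRecord₁₃H F N (Stage13HParams.ofHistoryBlind F N (Stage13RParams.ofCured F N θ₀)) p
                  (seqAllLargeOfRecord F θ₀.ν θ₀.τ9.M (gOfRecord₁₃ F N θ₀ p) p.K k))
                (seqAllLargeOfRecord F θ₀.ν θ₀.τ9.M (gOfRecord₁₃ F N θ₀ p) p.K k) t E
                (UbgOfRecord₁₃CoP F N θ₀ p k (seqAllLargeOfRecord F θ₀.ν θ₀.τ9.M (gOfRecord₁₃ F N θ₀ p) p.K k)) U) :=
  diag_lawsRT_slotClause_all_doorCured_of_step_of_liveSel θ₀ p h hg0 hE₀ hB₀ hsel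
    fun _ hk t₀ E₀ hid t' => clause_succ_forall_terms_doorCured_seqAllLarge_of_clause_of_core θ₀ p h hk hM t₀ E₀ hid t'

end DoorCured

/-! ## §3. ★★★★★ At the door of K0a's cured witness of record — `Provisos₁₃Core` at the witness (+ `0 ≤ g₀`) and nothing else -/

section DoorCuredRecord

variable (F N)
variable (p : B12.RunParams)

/-- **★★★★★ THEOREM 1 ALONG THE WHOLE LARGE-FIELD DIAGONAL AT THE DOOR OF K0a's CURED WITNESS OF RECORD `ofHistoryBlind (ofCured (theta13LiveOfRecord F N))`, CLAUSE LEVEL —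
HYPOTHESIS-FREE** (the K0-class core conjunct at the witness is `Node00.provisos₁₃Core_theta13LiveOfRecord`, the live-selector clause K0a's `liveRepin₁₃_liveSel`, `M = 1` by the
family's numerals): for every run `p` and every `k ≤ K`, term values and a constant with the post-𝐑 §2 dichotomy of `ρ_k`'s slot at the all-large-field index of length `k`.
[cite: Balaban1988Convergent, Thm 1 p.262, Theorem p.245, (3.24)–(3.25) p.270, (1.11) p.248, (3.16)–(3.22) pp.268–269; Balaban1989LargeFieldI, (0.3)–(0.4) p.176, p.177 (i)–(ii)] -/
theorem diag_slotClause_all_doorCured_theta13LiveOfRecord_of_core :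
    ∀ k, k ≤ p.K → ∃ (t : Sect2.TermValues (F.P p.K) (MatA N) (FluctV N) (theta13LiveOfRecord F N).τ9.M) (E : ℝ),
      slotsOfRecord F N (theta13LiveOfRecord F N).ν (theta13LiveOfRecord F N).τ9 (EOfRecord₁₃ F N (theta13LiveOfRecord F N))
          (wOfRecord₉ F N (theta13LiveOfRecord F N).toStage9Params) (theta13LiveOfRecord F N).ppSel p (gOfRecord₁₃ F N (theta13LiveOfRecord F N) p) k
          (seqAllLargeOfRecord F (theta13LiveOfRecord F N).ν (theta13LiveOfRecord F N).τ9.M (gOfRecord₁₃ F N (theta13LiveOfRecord F N) p) p.K k) = 0 ∨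
        ∀ᵐ U ∂fieldMeasure (F.P p.K) k (SU N),
          chiSeqOfRecord F N (theta13LiveOfRecord F N).ν (theta13LiveOfRecord F N).τ9.M (gOfRecord₁₃ F N (theta13LiveOfRecord F N) p) p.K k
              (seqAllLargeOfRecord F (theta13LiveOfRecord F N).ν (theta13LiveOfRecord F N).τ9.M (gOfRecord₁₃ F N (theta13LiveOfRecord F N) p) p.K k) U ≠ 0 →
            slotsOfRecord F N (theta13LiveOfRecord F N).ν (theta13LiveOfRecord F N).τ9 (EOfRecord₁₃ F N (theta13LiveOfRecord F N))
                (wOfRecord₉ F N (theta13LiveOfRecord F N).toStage9Params) (theta13LiveOfRecord F N).ppSel p (gOfRecord₁₃ F N (theta13LiveOfRecord F N) p) k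
                (seqAllLargeOfRecord F (theta13LiveOfRecord F N).ν (theta13LiveOfRecord F N).τ9.M (gOfRecord₁₃ F N (theta13LiveOfRecord F N) p) p.K k) U =
              sect2Slot F N (FluctV N) p.K (settingOfRecord₁₃ F N (theta13LiveOfRecord F N) p)
                ((Stage13HParams.ofHistoryBlind F N (Stage13RParams.ofCured F N (theta13LiveOfRecord F N))).rzAt p
                  (seqAllLargeOfRecord F (theta13LiveOfRecord F N).ν (theta13LiveOfRecord F N).τ9.M (gOfRecord₁₃ F N (theta13LiveOfRecord F N) p) p.K k))
                (WtOfRecord₁₃H F N (Stage13HParams.ofHistoryBlind F N (Stage13RParams.ofCured F N (theta13LiveOfRecord F N))) p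
                  (seqAllLargeOfRecord F (theta13LiveOfRecord F N).ν (theta13LiveOfRecord F N).τ9.M (gOfRecord₁₃ F N (theta13LiveOfRecord F N) p) p.K k))
                (seqAllLargeOfRecord F (theta13LiveOfRecord F N).ν (theta13LiveOfRecord F N).τ9.M (gOfRecord₁₃ F N (theta13LiveOfRecord F N) p) p.K k) t E
                (UbgOfRecord₁₃CoP F N (theta13LiveOfRecord F N) p k
                  (seqAllLargeOfRecord F (theta13LiveOfRecord F N).ν (theta13LiveOfRecord F N).τ9.M (gOfRecord₁₃ F N (theta13LiveOfRecord F N) p) p.K k)) U :=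
  diag_slotClause_all_doorCured_of_provisosCore_of_liveSel_of_core (theta13LiveOfRecord F N) p (provisos₁₃Core_theta13LiveOfRecord F N)
    (liveRepin₁₃_liveSel F N (theta13OfFamily F N eps0OfRecord₁₃ _ _ _)) (le_of_eq rfl)

/-- **★★★★★ … WITH ITS LAW PACKAGE at the door of the cured witness of record — from the run's `0 ≤ g₀` ALONE** (core conjunct `Node00.provisos₁₃Core_theta13LiveOfRecord`;
`E₀ = B₀ = 1`, `M = 1` by the family's numerals; selector clause `liveRepin₁₃_liveSel`): for every `k ≤ K`, BOTH conjuncts of the §2 form of `ρ_k` at the all-large index of length `k` — the inductive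
assumptions (2.27)–(2.31), (2.41)–(2.42) with analyticity (zero witness) AND the post-𝐑 §2 dichotomy. [cite: Balaban1988Convergent, Thm 1 p.262, §2 p.262, Theorem p.245, (3.24)–(3.25) p.270, (1.11) p.248, (3.16)–(3.22) pp.268–269, (2.27)–(2.31) pp.259–260; Balaban1989LargeFieldI, (0.3)–(0.4) p.176, p.177 (i)–(ii); Balaban1987RG1, (0.20) p.256] -/
theorem diag_lawsRT_slotClause_all_doorCured_theta13LiveOfRecord_of_core (hg0 : 0 ≤ p.g0) :
    ∀ k, k ≤ p.K → ∃ (t : Sect2.TermValues (F.P p.K) (MatA N) (FluctV N) (theta13LiveOfRecord F N).τ9.M) (E : ℝ),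
      Sect2.LawsRT (sect2TowerOfRecord F N (FluctV N) p.K (settingOfRecord₁₃ F N (theta13LiveOfRecord F N) p)
        ((Stage13HParams.ofHistoryBlind F N (Stage13RParams.ofCured F N (theta13LiveOfRecord F N))).rzAt p
          (seqAllLargeOfRecord F (theta13LiveOfRecord F N).ν (theta13LiveOfRecord F N).τ9.M (gOfRecord₁₃ F N (theta13LiveOfRecord F N) p) p.K k))
        (seqAllLargeOfRecord F (theta13LiveOfRecord F N).ν (theta13LiveOfRecord F N).τ9.M (gOfRecord₁₃ F N (theta13LiveOfRecord F N) p) p.K k) t)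
        (settingOfRecord₁₃ F N (theta13LiveOfRecord F N) p).lf k ∧
     (slotsOfRecord F N (theta13LiveOfRecord F N).ν (theta13LiveOfRecord F N).τ9 (EOfRecord₁₃ F N (theta13LiveOfRecord F N))
          (wOfRecord₉ F N (theta13LiveOfRecord F N).toStage9Params) (theta13LiveOfRecord F N).ppSel p (gOfRecord₁₃ F N (theta13LiveOfRecord F N) p) k
          (seqAllLargeOfRecord F (theta13LiveOfRecord F N).ν (theta13LiveOfRecord F N).τ9.M (gOfRecord₁₃ F N (theta13LiveOfRecord F N) p) p.K k) = 0 ∨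
        ∀ᵐ U ∂fieldMeasure (F.P p.K) k (SU N),
          chiSeqOfRecord F N (theta13LiveOfRecord F N).ν (theta13LiveOfRecord F N).τ9.M (gOfRecord₁₃ F N (theta13LiveOfRecord F N) p) p.K k
              (seqAllLargeOfRecord F (theta13LiveOfRecord F N).ν (theta13LiveOfRecord F N).τ9.M (gOfRecord₁₃ F N (theta13LiveOfRecord F N) p) p.K k) U ≠ 0 →
            slotsOfRecord F N (theta13LiveOfRecord F N).ν (theta13LiveOfRecord F N).τ9 (EOfRecord₁₃ F N (theta13LiveOfRecord F N))
                (wOfRecord₉ F N (theta13LiveOfRecord F N).toStage9Params) (theta13LiveOfRecord F N).ppSel p (gOfRecord₁₃ F N (theta13LiveOfRecord F N) p) k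
                (seqAllLargeOfRecord F (theta13LiveOfRecord F N).ν (theta13LiveOfRecord F N).τ9.M (gOfRecord₁₃ F N (theta13LiveOfRecord F N) p) p.K k) U =
              sect2Slot F N (FluctV N) p.K (settingOfRecord₁₃ F N (theta13LiveOfRecord F N) p)
                ((Stage13HParams.ofHistoryBlind F N (Stage13RParams.ofCured F N (theta13LiveOfRecord F N))).rzAt p
                  (seqAllLargeOfRecord F (theta13LiveOfRecord F N).ν (theta13LiveOfRecord F N).τ9.M (gOfRecord₁₃ F N (theta13LiveOfRecord F N) p) p.K k))
                (WtOfRecord₁₃H F N (Stage13HParams.ofHistoryBlind F N (Stage13RParams.ofCured F N (theta13LiveOfRecord F N))) p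
                  (seqAllLargeOfRecord F (theta13LiveOfRecord F N).ν (theta13LiveOfRecord F N).τ9.M (gOfRecord₁₃ F N (theta13LiveOfRecord F N) p) p.K k))
                (seqAllLargeOfRecord F (theta13LiveOfRecord F N).ν (theta13LiveOfRecord F N).τ9.M (gOfRecord₁₃ F N (theta13LiveOfRecord F N) p) p.K k) t E
                (UbgOfRecord₁₃CoP F N (theta13LiveOfRecord F N) p k
                  (seqAllLargeOfRecord F (theta13LiveOfRecord F N).ν (theta13LiveOfRecord F N).τ9.M (gOfRecord₁₃ F N (theta13LiveOfRecord F N) p) p.K k)) U) :=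
  diag_lawsRT_slotClause_all_doorCured_theta13LiveOfRecord_of_step F N p (provisos₁₃Core_theta13LiveOfRecord F N) hg0
    fun _ hk t₀ E₀ hid t' => clause_succ_forall_terms_doorCured_seqAllLarge_of_clause_of_core (theta13LiveOfRecord F N) p
      (provisos₁₃Core_theta13LiveOfRecord F N) hk (le_of_eq rfl) t₀ E₀ hid t'

end DoorCuredRecord

end Summit.QuantumFields.YangMills.Theorems.BalabanUVNodesN11DiagonalInductionNoBindersCoPH

end
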